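import Summits.Ventures.PercRepro.ClassHarris
import Summits.Ventures.PercRepro.ClassVdBHK

/-!
# PercRepro — C-024: the 246 Harris–Kleitman orbits are theorems (typer-2, gen 7)

The referee's cone decomposition of C-024 «CLASS-vdBHK» (ref-2 g7, CONSEQUENCE §4; re-verified by mine-4 g5 with
own code, `data/mine-4/g5/C024-OPEN-PART.md`): of the 313 `S₄`-orbits of the 5,609 class-level vdBHK06 kernels
(`gen_k7.py` Theorem 2.1 placements, `gen_k5.py` Theorem 1.1 placements), 246 orbits (4,304 placements) lie in the
cone spanned by the Harris class kernels `H_{U,U′}(s, t) = (U(s) − U(t)) (U′(s) − U′(t))` (`U, U′` up-sets of the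
coarsening order on the 15 marked partitions) and the entrywise-nonnegative kernels: 157 orbits are entrywise `≥ 0`,
89 are `H_{U,U′} +` (entrywise `≥ 0`) with one Harris kernel of multiplier 1. This file makes every one of the 246
a kernel-checked theorem, by **stamp 83 (`classHarris`, Kleitman on every face) + one entrywise comparison each**
(the lead, ASSIGNMENTS v51):

* `rowLE` is the coarsening order on the rows (`t` coarser than `s` iff every literal true on `s` is true on `t`);
  `IsRowUpSet U` (decidable) says the `0/1` table `U` is an up-set; `harrisKernel U U′` is `H_{U,U′}`.
* **`classNonneg_harrisKernel`**: for up-sets `U, U′` the Harris class kernel is class-nonnegative on every face of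
  every marked multigraph — the antipodal sum is `2 (#{ρ : ρ ∈ A ∩ B} − #{ρ : ρ ∈ A, ρᶜ ∈ B})` for the increasing
  events `A = {row ∈ U}`, `B = {row ∈ U′}` (`rowLE_row4_markedPartition`, `isUpperSet_rowEvent`), which is `≥ 0` by
  `classHarris`.
* `classNonneg_of_le`: class-nonnegativity passes to every entrywise-larger kernel; hence
  `thm21ClassThm_of_harris` / `thm11ClassThm_of_harris`: a placement whose kernel dominates `H_{U,U′}` entrywise is
  a class theorem (`Thm21ClassThm` / `Thm11ClassThm` = admissibility of `f, g` + `ClassNonneg` of the kernel); the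
  entrywise-nonnegative case is `U = U′ = ∅`.
* The 246 orbit theorems `c024_inside_001` … `c024_inside_246` live in the companion files
  `ClassVdBHKHarris1` … `ClassVdBHKHarris4` (the farm's 512 KiB cap on a check file forbids one file), one theorem
  per INSIDE orbit in the order of the referee's VERDICT list; the representative placement is the tagged one of
  `k57_kernels.txt.gz` (`f`, `g` as monotone DNFs of the joint literal vector via `lit21`, `A`, `B` of the star
  literals via `star11`; `monotone_lit` / `monotone_band` / `monotone_bor`), the Harris pair is the referee's
  (`upOf`), relabelled by a mark permutation for the 45 orbits whose decomposition is printed for another member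
  of the orbit. Every `by decide` is a 15 × 15 integer comparison.

The 67 remaining orbits (1,305 placements, `data/mine-4/g5/c024_open67.tsv`) are the open part C-024′ — nothing
about them is claimed here.
-/

namespace PercRepro

open Finset

/-! ### Monotone Boolean combinators -/

/-- A literal read off a vector is monotone. -/
theorem monotone_lit (ij : Fin 4 × Fin 4) : Monotone fun x : Fin 4 × Fin 4 → Bool => x ij :=
  fun _ _ h => h ij

/-- The conjunction of two monotone Boolean functions is monotone. -/
theorem monotone_band {α : Type*} [Preorder α] {f g : α → Bool} (hf : Monotone f) (hg : Monotone g) :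
    Monotone fun x => f x && g x := fun _ _ h =>
  Bool.le_and (le_trans (Bool.and_le_left _ _) (hf h)) (le_trans (Bool.and_le_right _ _) (hg h))

/-- The disjunction of two monotone Boolean functions is monotone. -/
theorem monotone_bor {α : Type*} [Preorder α] {f g : α → Bool} (hf : Monotone f) (hg : Monotone g) :
    Monotone fun x => f x || g x := fun _ _ h =>
  Bool.or_le (le_trans (hf h) (Bool.left_le_or _ _)) (le_trans (hg h) (Bool.right_le_or _ _))

/-! ### The coarsening order on the rows and the Harris class kernels -/

/-- The coarsening order on the engine rows: `rowLE s t` when every literal `i ~ j` true on `s` is true on `t`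
(`t` is coarser than `s`). -/
def rowLE (s t : Fin 15) : Prop := ∀ i j : Fin 4, rowConn s i j = true → rowConn t i j = true

/-- `rowLE` is a decidable relation (unfold and decide). -/
instance : DecidableRel rowLE := fun _ _ => by unfold rowLE; infer_instance

/-- A `0/1` table on the rows is an up-set of the coarsening order. -/
def IsRowUpSet (U : Fin 15 → Bool) : Prop := ∀ s t, rowLE s t → U s = true → U t = true

/-- `IsRowUpSet` is decidable (unfold and decide the finite conjunction). -/
instance : DecidablePred IsRowUpSet := fun _ => by unfold IsRowUpSet; infer_instance

/-- The Harris class kernel of two row tables: `H_{U,U′}(s, t) = (U(s) − U(t)) (U′(s) − U′(t))`. -/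
def harrisKernel (U U' : Fin 15 → Bool) (s t : Fin 15) : ℤ :=
  (bInd (U s) - bInd (U t)) * (bInd (U' s) - bInd (U' t))

/-- Opening edges coarsens the row of the marked partition. -/
theorem MultiGraph.rowLE_row4_markedPartition {V E : Type*} (G : MultiGraph V E) {ω ω' : Config E}
    (h : ω ≤ ω') (m : Fin 4 → V) :
    rowLE (row4 (G.markedPartition ω m)) (row4 (G.markedPartition ω' m)) := by
  classical
  intro i j hij
  rw [rowConn_row4_markedPartition, decide_eq_true_iff] at hij ⊢
  exact hij.mono h

/-- The event «the row of the marked partition lies in the up-set `U`» is increasing. -/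
theorem MultiGraph.isUpperSet_rowEvent {V E : Type*} (G : MultiGraph V E) (m : Fin 4 → V)
    {U : Fin 15 → Bool} (hU : IsRowUpSet U) :
    IsUpperSet {ω : Config E | U (row4 (G.markedPartition ω m)) = true} :=
  fun _ _ h hω => hU _ _ (G.rowLE_row4_markedPartition h m) hω

/-- `bInd x · bInd y` is the indicator of `x = true ∧ y = true`. -/
theorem bInd_mul_bInd (x y : Bool) :
    ((bInd x : ℤ) : ℝ) * ((bInd y : ℤ) : ℝ) = if x = true ∧ y = true then 1 else 0 := by
  cases x <;> cases y <;> simp [bInd]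

/-- The antipodal sum of a Harris class kernel along any row map `r` on a cube is
`2 (#{ρ : r ρ ∈ U ∧ r ρ ∈ U′} − #{ρ : r ρ ∈ U ∧ r ρᶜ ∈ U′})`. -/
theorem sum_harrisKernel_eq {S : Type*} [Fintype S] [DecidableEq S] (r : Config S → Fin 15)
    (U U' : Fin 15 → Bool) :
    ∑ ρ : Config S, (harrisKernel U U' (r ρ) (r ρᶜ) : ℝ) =
      2 * (((univ.filter fun ρ : Config S => U (r ρ) = true ∧ U' (r ρ) = true).card : ℝ) -
            ((univ.filter fun ρ : Config S => U (r ρ) = true ∧ U' (r ρᶜ) = true).card : ℝ)) := by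
  have hterm : ∀ ρ : Config S, (harrisKernel U U' (r ρ) (r ρᶜ) : ℝ) =
      ((bInd (U (r ρ)) : ℤ) : ℝ) * ((bInd (U' (r ρ)) : ℤ) : ℝ) +
        ((bInd (U (r ρᶜ)) : ℤ) : ℝ) * ((bInd (U' (r ρᶜ)) : ℤ) : ℝ) -
        ((bInd (U (r ρ)) : ℤ) : ℝ) * ((bInd (U' (r ρᶜ)) : ℤ) : ℝ) -
        ((bInd (U (r ρᶜ)) : ℤ) : ℝ) * ((bInd (U' (r ρ)) : ℤ) : ℝ) := by
    intro ρ
    simp only [harrisKernel]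
    push_cast
    ring
  have hswap1 : ∑ ρ : Config S, ((bInd (U (r ρᶜ)) : ℤ) : ℝ) * ((bInd (U' (r ρᶜ)) : ℤ) : ℝ) =
      ∑ ρ : Config S, ((bInd (U (r ρ)) : ℤ) : ℝ) * ((bInd (U' (r ρ)) : ℤ) : ℝ) :=
    Equiv.sum_comp complPerm fun ρ => ((bInd (U (r ρ)) : ℤ) : ℝ) * ((bInd (U' (r ρ)) : ℤ) : ℝ)
  have hswap2 : ∑ ρ : Config S, ((bInd (U (r ρᶜ)) : ℤ) : ℝ) * ((bInd (U' (r ρ)) : ℤ) : ℝ) =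
      ∑ ρ : Config S, ((bInd (U (r ρ)) : ℤ) : ℝ) * ((bInd (U' (r ρᶜ)) : ℤ) : ℝ) := by
    refine Fintype.sum_equiv complPerm _ _ fun ρ => ?_
    simp only [complPerm, Function.Involutive.coe_toPerm, compl_compl]
  have hc1 : ∑ ρ : Config S, ((bInd (U (r ρ)) : ℤ) : ℝ) * ((bInd (U' (r ρ)) : ℤ) : ℝ) =
      ((univ.filter fun ρ : Config S => U (r ρ) = true ∧ U' (r ρ) = true).card : ℝ) := by
    simp only [bInd_mul_bInd]
    rw [Finset.sum_boole]
  have hc2 : ∑ ρ : Config S, ((bInd (U (r ρ)) : ℤ) : ℝ) * ((bInd (U' (r ρᶜ)) : ℤ) : ℝ) =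
      ((univ.filter fun ρ : Config S => U (r ρ) = true ∧ U' (r ρᶜ) = true).card : ℝ) := by
    simp only [bInd_mul_bInd]
    rw [Finset.sum_boole]
  simp only [hterm, Finset.sum_add_distrib, Finset.sum_sub_distrib, hswap1, hswap2, hc1, hc2]
  ring

/-- `classHarris` with the decidability instances of the ambient context. -/
theorem classHarris' {E : Type*} [Fintype E] [DecidableEq E] (A B : Set (Config E))
    [DecidablePred (· ∈ A)] [DecidablePred (· ∈ B)] (hA : IsUpperSet A) (hB : IsUpperSet B)
    (u v : Config E) :
    (univ.filter fun ρ : Config (Face u v) => embed u v ρ ∈ A ∧ embed u v ρᶜ ∈ B).card ≤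
      (univ.filter fun ρ : Config (Face u v) => embed u v ρ ∈ A ∧ embed u v ρ ∈ B).card := by
  have h := classHarris A B hA hB u v
  convert h using 3

/-- **The Harris class kernel of two up-sets is class-nonnegative** (stamp 83 `classHarris` on the row events). -/
theorem classNonneg_harrisKernel {U U' : Fin 15 → Bool} (hU : IsRowUpSet U) (hU' : IsRowUpSet U') :
    ClassNonneg fun s t => (harrisKernel U U' s t : ℝ) := by
  intro V E _ _ G a b c d u v _
  rw [sum_harrisKernel_eq (fun ρ => row4 (G.markedPartition (embed u v ρ) ![a, b, c, d])) U U']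
  have h := classHarris' {ω : Config E | U (row4 (G.markedPartition ω ![a, b, c, d])) = true}
    {ω : Config E | U' (row4 (G.markedPartition ω ![a, b, c, d])) = true}
    (G.isUpperSet_rowEvent _ hU) (G.isUpperSet_rowEvent _ hU') u v
  simp only [Set.mem_setOf_eq] at h
  have h' : ((univ.filter fun ρ : Config (Face u v) =>
      U (row4 (G.markedPartition (embed u v ρ) ![a, b, c, d])) = true ∧
        U' (row4 (G.markedPartition (embed u v ρᶜ) ![a, b, c, d])) = true).card : ℝ) ≤
      ((univ.filter fun ρ : Config (Face u v) =>
      U (row4 (G.markedPartition (embed u v ρ) ![a, b, c, d])) = true ∧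
        U' (row4 (G.markedPartition (embed u v ρ) ![a, b, c, d])) = true).card : ℝ) := by
    exact_mod_cast h
  linarith

/-- Class-nonnegativity passes to every entrywise-larger kernel. -/
theorem classNonneg_of_le {K K' : Fin 15 → Fin 15 → ℝ} (hK : ClassNonneg K) (h : ∀ s t, K s t ≤ K' s t) :
    ClassNonneg K' := by
  intro V E _ _ G a b c d u v huv
  exact le_trans (hK G a b c d u v huv) (Finset.sum_le_sum fun ρ _ => h _ _)

/-! ### Class theorems for single placements -/

/-- The row function `φ ∘ litVec21 S T` of a Boolean function `φ` of the joint literal vector. -/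
def lit21 (S T : Finset (Fin 4)) (φ : (Fin 4 × Fin 4 → Bool) → Bool) : Fin 15 → Bool :=
  fun s => φ (litVec21 S T s)

/-- The row function `φ ∘ starVec11 s` of a Boolean function `φ` of the star literals at `s`. -/
def star11 (s : Fin 4) (φ : (Fin 4 × Fin 4 → Bool) → Bool) : Fin 15 → Bool :=
  fun p => φ (starVec11 s p)

/-- The `0/1` table of a set of rows. -/
def upOf (U : Finset (Fin 15)) : Fin 15 → Bool := fun s => decide (s ∈ U)

/-- The class-level statement of one Theorem 2.1 placement `(S, T, f, g)`: `f`, `g` admissible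
(`IsMonoLit21`) and the kernel class-nonnegative — the instance of `C024Thm21` at this placement. -/
def Thm21ClassThm (S T : Finset (Fin 4)) (f g : Fin 15 → Bool) : Prop :=
  IsMonoLit21 S T f ∧ IsMonoLit21 S T g ∧ ClassNonneg fun s t => (kernel21 S T f g s t : ℝ)

/-- The class-level statement of one Theorem 1.1 placement `(s, A, B, X, Y)`: `A`, `B` admissible
(`IsMonoStar11`) and the kernel class-nonnegative — the instance of `C024Thm11` at this placement. -/
def Thm11ClassThm (s : Fin 4) (A B : Fin 15 → Bool) (X Y : Finset (Fin 4)) : Prop :=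
  IsMonoStar11 s A ∧ IsMonoStar11 s B ∧ ClassNonneg fun p q => (kernel11 s A B X Y p q : ℝ)

/-- **A Theorem 2.1 placement whose kernel dominates a Harris class kernel entrywise is a class theorem.**
`f = lit21 S T φ`, `g = lit21 S T ψ` with `φ, ψ` monotone; `U, U′` up-sets; `H_{U,U′} ≤ K` entrywise. -/
theorem thm21ClassThm_of_harris (S T : Finset (Fin 4)) (φ ψ : (Fin 4 × Fin 4 → Bool) → Bool)
    (hφ : Monotone φ) (hψ : Monotone ψ) (U U' : Fin 15 → Bool) (hU : IsRowUpSet U) (hU' : IsRowUpSet U')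
    (h : ∀ s t, harrisKernel U U' s t ≤ kernel21 S T (lit21 S T φ) (lit21 S T ψ) s t) :
    Thm21ClassThm S T (lit21 S T φ) (lit21 S T ψ) := by
  unfold Thm21ClassThm
  refine ⟨⟨φ, hφ, fun _ => rfl⟩, ⟨ψ, hψ, fun _ => rfl⟩, ?_⟩
  intro V E _ _ G a b c d u v huv
  exact le_trans (classNonneg_harrisKernel hU hU' G a b c d u v huv)
    (Finset.sum_le_sum fun ρ _ => by beta_reduce; exact_mod_cast h _ _)

/-- **A Theorem 1.1 placement whose kernel dominates a Harris class kernel entrywise is a class theorem.**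
`A = star11 s φ`, `B = star11 s ψ` with `φ, ψ` monotone; `U, U′` up-sets; `H_{U,U′} ≤ K` entrywise. -/
theorem thm11ClassThm_of_harris (s : Fin 4) (φ ψ : (Fin 4 × Fin 4 → Bool) → Bool)
    (hφ : Monotone φ) (hψ : Monotone ψ) (X Y : Finset (Fin 4)) (U U' : Fin 15 → Bool)
    (hU : IsRowUpSet U) (hU' : IsRowUpSet U')
    (h : ∀ p q, harrisKernel U U' p q ≤ kernel11 s (star11 s φ) (star11 s ψ) X Y p q) :
    Thm11ClassThm s (star11 s φ) (star11 s ψ) X Y := by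
  unfold Thm11ClassThm
  refine ⟨⟨φ, hφ, fun _ => rfl⟩, ⟨ψ, hψ, fun _ => rfl⟩, ?_⟩
  intro V E _ _ G a b c d u v huv
  exact le_trans (classNonneg_harrisKernel hU hU' G a b c d u v huv)
    (Finset.sum_le_sum fun ρ _ => by beta_reduce; exact_mod_cast h _ _)

end PercRepro
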